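import Literature.NumberTheory.Rogawski1990.ArchExplicitTransferFactorNondegenerate
import HarnessLib

/-!
# `Δ″_∞ ≠ 0`, `Δ‴_∞ ≠ 0` and `κ‴_w = ±1` at every `(G,H)`-REGULAR LOCAL matching pair (Rogawski 1990, Prop. 8.2.1, p. 117; §14.6 p. 242)

Topic `NumberTheory/Rogawski1990`; namespace `Literature.NumberTheory.Rogawski1990`.  THEOREMS ONLY (no definition, no named fact, no
instance, no notation, no `sorry`); imports ★ `ArchExplicitTransferFactorNondegenerate` (N2∞; hence ★ `ArchCanonicalTransferFactor`, ★
`ArchExplicitTransferFactorRegular`) only.  Cell `pub/hodgecm-mathlib`, F0∕P3a, seat F0P3a-p08 (g11); part 1 of the brick «D-G4♭-∞» (the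
archimedean twin of F0P3a-p05 (g10)'s finite-place «D-G4♭») of the #88 repair census `F0/P3a/F0P3a-p05/g9/SIZING-S1prime.v2.F0P3a-p05g9.md`
§2 rows (ST-∞-s)∕(κ-arch); part 2 is `ArchExplicitTransferFactorContinuous` (continuity of `Δ‴_∞` on the `(G,H)`-regular matching locus).

WHAT.  ★ N2∞ (`ArchExplicitTransferFactorNondegenerate`, B-p12) proves `κ_w(γ_H, γ′) ≠ 0` and `Δ″_∞(γ_H, γ′) ≠ 0` on matching pairs with `γ_H`
**`G`-regular** (★ `IsArchGRegular`: `χ_{ι(γ_H)}` separable over `L ⊗ ℝ`), and F0P3a-p05 (g9)'s (P-γ) `ExplicitFactorProductFormulaGHRegularArch`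
proves the same at the `(G,H)`-regular RATIONAL pairs `γ_H ⊗ 1 ↔ γ ⊗ 1` (through the Hilbert symbol of a global element).  At print's singular
`γ₀ ∈ M` [Rogawski1990, Prop. 8.2.1 p. 117; Lemma 14.5.2 (b) proof p. 238] the partner `γ_H = (e₁•1₂, e₂)` is only `(G,H)`-regular, and the limit
arguments of (κ-arch)∕(ST-∞-s) run through LOCAL (real-analytic, non-rational) pairs `(γ_H δ_t, γ δ_t)` near it.  This file removes both
restrictions: every statement of ★ N2∞ holds at a LOCAL matching pair under the sole hypothesis
  `σ_w(χ_g(γ₂)) ≠ 0` at the complex place `w` in question (resp. `χ_g(γ₂) ∈ (L ⊗ ℝ)ˣ` for the global-in-`w` statements),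
because the eigen-covector argument of ★ `star_dotProduct_form_mulVec_ne_zero_of_conj_eq` uses `G`-regularity only through that
non-vanishing (its Step C).  The proofs are the ★ proofs with this one input replaced; nothing is restated.
* §0 (private) `evalC_ne_zero_of_isUnit` — a unit of `L ⊗ ℝ` is non-zero at every complex place.
* §1 `isUnit_archTauArg_of_isUnit_eval`, `archTau_ne_zero_of_isUnit_eval`, `archWeylRatio_ne_zero_of_isUnit_eval` — `τ_∞ ≠ 0`, `D_{G∕H,∞} ≠ 0`.
* §2 **`star_dotProduct_form_mulVec_ne_zero_of_conj_eq_of_evalC_ne_zero`** — the distinguished eigenline `v = c_w e₂` of `γ′_w = c_w ι_w c_w⁻¹` is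
  not `w(H′)`-isotropic (`hanis`: `H′` anisotropic).
* §3 **`re_trace_archEigenlineProjector_ne_zero_of_evalC_ne_zero`** (`Re tr(P_wᴴ w(H′) P_w) ≠ 0`; `hherm`, `hanis`), hence
  `archKappaSignAt_ne_zero_of_evalC_ne_zero`, **`archKappaSignAt_eq_one_or_eq_neg_one_of_evalC_ne_zero`** («`κ(γ, ψ_v(iγ)) = ±1`» at every
  `(G,H)`-regular local pair), `archKappaAt_ne_zero_of_evalC_ne_zero`.
* §4 HEADS **`archExplicitDelta_ne_zero_of_isUnit_eval`**, **`archCanonicalDelta_ne_zero_of_isUnit_eval`** — `Δ″_∞(γ_H, γ′) ≠ 0` and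
  `Δ‴_∞(γ_H, γ′) ≠ 0` at every local matching pair with `χ_g(γ₂) ∈ (L ⊗ ℝ)ˣ` (the `c_∞ ≠ 0` DATA fact of Lemma 14.5.2 (b) in full local generality).
HONEST LABEL: HC_CM is proved only modulo the printed citations until rung 0 closes; count-neutral brick toward the letter S1′
`stub_tamagawaSingularMembers_exist` of `Cruxes/H413/Lines/F0_P3a_SingularEllipticTransferPaydown.lean` — no stub closes; the archimedean
κ-identity (κ-arch) itself remains print.

## References
* [Rogawski1990] J. D. Rogawski, *Automorphic Representations of Unitary Groups in Three Variables*, Ann. of Math. Stud. 123 (1990), §8.2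
  Prop. 8.2.1 p. 117; §14.5 Lemma 14.5.2 (b), proof p. 238; §4.9 p. 55; §14.6 p. 242; §3.6 pp. 28–29.
* [LanglandsShelstad1987] R. P. Langlands, D. Shelstad, *On the definition of transfer factors*, Math. Ann. 278 (1987), §2.
-/

set_option autoImplicit false

noncomputable section

open NumberField NumberField.InfinitePlace NumberField.mixedEmbedding Matrix Polynomial
open Literature.NumberTheory.GaloisRepresentations
open Literature.AlgebraicGeometry.ShimuraVarieties (hermForm)
open scoped MatrixGroups ComplexOrder

namespace Literature.NumberTheory.Rogawski1990

open Literature.NumberTheory.Automorphic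

/-! ## §0 Units of `L ⊗ ℝ` and the complex places -/

section UnitsAux

variable (L : Type) [Field L] [NumberField L]

omit [NumberField L] in
/-- A unit of `L ⊗ ℝ` has non-zero coordinate at every complex place. [folklore] -/
private theorem evalC_ne_zero_of_isUnit [NumberField L] {x : mixedSpace L} (hx : IsUnit x) (w : {w : InfinitePlace L // IsComplex w}) :
    UnitaryGroup.evalC L w x ≠ 0 := by
  rw [UnitaryGroup.evalC_apply]
  exact ((Pi.isUnit_iff.1 (Prod.isUnit_iff.1 hx).2) w).ne_zero

end UnitsAux

/-! ## §1 `τ_∞ ≠ 0`, `D_{G∕H,∞} ≠ 0` under `χ_g(γ₂) ∈ (L ⊗ ℝ)ˣ` -/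

section TauWeyl

variable (L : Type) [Field L] [NumberField L] [IsCMField L]
  (a : ↥(UnitaryGroup.arch (↥(maximalRealSubfield L)) L (IsCMField.complexConj L) 2
      (Matrix.of fun i j : Fin 2 => if i.val + j.val + 1 = 2 then (1 : L) else 0)) ×
    ↥(UnitaryGroup.arch (↥(maximalRealSubfield L)) L (IsCMField.complexConj L) 1
      (Matrix.of fun i j : Fin 1 => if i.val + j.val + 1 = 1 then (1 : L) else 0)))

/-- `τ`'s argument `−χ_g(γ₂) · det g⁻¹` is a unit as soon as `χ_g(γ₂)` is (★ `isUnit_archTauArg_of_isArchGRegular` with `G`-regularity weakened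
to `(G,H)`-regularity). [cite: Rogawski1990, §4.9 p. 55] -/
theorem isUnit_archTauArg_of_isUnit_eval (h : IsUnit ((archCharpolyTwo L a).eval (archGammaTwo L a))) : IsUnit (archTauArg L a) := by
  unfold archTauArg
  exact (h.neg).mul (Matrix.isUnits_det_units _)

/-- **`τ_∞(γ_H) ≠ 0`** as soon as `χ_g(γ₂) ∈ (L ⊗ ℝ)ˣ` (★ `archTau_ne_zero_of_isArchGRegular`, weakened): both Hecke values are taken at units.
[cite: Rogawski1990, §4.9 p. 55] -/
theorem archTau_ne_zero_of_isUnit_eval (μ : HeckeCharacter L) (h : IsUnit ((archCharpolyTwo L a).eval (archGammaTwo L a))) :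
    archTau L a μ ≠ 0 :=
  mul_ne_zero (archHeckeValue_ne_zero_of_isUnit L μ (isUnit_archGammaTwo L a))
    (inv_ne_zero (archHeckeValue_ne_zero_of_isUnit L μ (isUnit_archTauArg_of_isUnit_eval L a h)))

open scoped Classical in
/-- **`D_{G∕H,∞}(γ_H) ≠ 0`** as soon as `χ_g(γ₂) ∈ (L ⊗ ℝ)ˣ` (★ `archWeylRatio_ne_zero_of_isArchGRegular`, weakened). [cite: Rogawski1990, §4.9 p. 55] -/
theorem archWeylRatio_ne_zero_of_isUnit_eval (h : IsUnit ((archCharpolyTwo L a).eval (archGammaTwo L a))) : archWeylRatio L a ≠ 0 := by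
  unfold archWeylRatio
  exact Finset.prod_ne_zero_iff.2 fun w _ => norm_ne_zero_iff.2 (evalC_ne_zero_of_isUnit L h w)

end TauWeyl

/-! ## §2 The distinguished eigenline is anisotropic under `σ_w(χ_g(γ₂)) ≠ 0` (★ `star_dotProduct_form_mulVec_ne_zero_of_conj_eq`, weakened) -/

section Algebra

variable {n : Type*} [Fintype n]

/-- `r̄ · r = Σ_i |r_i|²` (as a real number). [folklore] -/
private theorem star_dotProduct_self_eq_ofReal_gh (r : n → ℂ) :
    star r ⬝ᵥ r = ((∑ i, Complex.normSq (r i) : ℝ) : ℂ) := by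
  rw [Complex.ofReal_sum]
  simp only [dotProduct, Pi.star_apply, Complex.star_def, Complex.normSq_eq_conj_mul_self]

/-- `Σ |r_i|² = 0 ↔ r = 0`. [folklore] -/
private theorem sum_normSq_eq_zero_iff_gh (r : n → ℂ) : (∑ i, Complex.normSq (r i)) = 0 ↔ r = 0 := by
  rw [← Complex.ofReal_eq_zero, ← star_dotProduct_self_eq_ofReal_gh, dotProduct_star_self_eq_zero]

/-- Trace of a rank-one hermitian congruence: `tr((p qᵀ)ᴴ H (p qᵀ)) = (q^† q) · (p^† H p)`. [folklore] -/
private theorem trace_conjTranspose_vecMulVec_mul_mul_gh (p q : n → ℂ) (H : Matrix n n ℂ) :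
    ((vecMulVec p q)ᴴ * H * vecMulVec p q).trace = (star q ⬝ᵥ q) * (star p ⬝ᵥ H *ᵥ p) := by
  rw [conjTranspose_vecMulVec, vecMulVec_mul, vecMulVec_mul_vecMulVec, trace_vecMulVec, dotProduct_smul, ← dotProduct_mulVec,
    smul_eq_mul, mul_comm]

end Algebra

section Place

variable (L : Type) [Field L] [NumberField L] [IsCMField L] (H' : Matrix (Fin 3) (Fin 3) L)
  (a : ↥(UnitaryGroup.arch (↥(maximalRealSubfield L)) L (IsCMField.complexConj L) 2
      (Matrix.of fun i j : Fin 2 => if i.val + j.val + 1 = 2 then (1 : L) else 0)) ×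
    ↥(UnitaryGroup.arch (↥(maximalRealSubfield L)) L (IsCMField.complexConj L) 1
      (Matrix.of fun i j : Fin 1 => if i.val + j.val + 1 = 1 then (1 : L) else 0)))
  (b : ↥(UnitaryGroup.arch (↥(maximalRealSubfield L)) L (IsCMField.complexConj L) 3 H'))
  (w : {w : InfinitePlace L // IsComplex w})

/-- **The distinguished eigenline is not `w(H′)`-isotropic at a `(G,H)`-regular pair**: for `γ′ = c ι(γ_H) c⁻¹` with `σ_w(χ_g(γ₂)) ≠ 0` and
`H′` anisotropic, `vᴴ · w(H′) · v ≠ 0` for `v = c_w e₂` — ★ `star_dotProduct_form_mulVec_ne_zero_of_conj_eq` with `G`-regularity of `γ_H`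
WEAKENED to the non-vanishing of `σ_w(χ_g(γ₂))` (the only use regularity had there: the outer coordinates of the left `γ₂,w`-eigen-covector
`vᴴ w(H′) c_w` of the pattern `ι_w` vanish because `χ_{g_w}(γ₂,w) ≠ 0`). [cite: Rogawski1990, §3.6 pp. 28–29; §14.6 p. 242] -/
theorem star_dotProduct_form_mulVec_ne_zero_of_conj_eq_of_evalC_ne_zero
    (hanis : ∀ x : Fin 3 → L, hermForm (cmConjRingHom L) H' x x = 0 → x = 0)
    (hw : UnitaryGroup.evalC L w ((archCharpolyTwo L a).eval (archGammaTwo L a)) ≠ 0)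
    (c : GL (Fin 3) (mixedSpace L))
    (hc : c * ((endoEmbArch L a : ↥(UnitaryGroup.arch (↥(maximalRealSubfield L)) L (IsCMField.complexConj L) 3
            (Matrix.of fun i j : Fin 3 => if i.val + j.val + 1 = 3 then (1 : L) else 0))) :
            GL (Fin 3) (mixedSpace L)) * c⁻¹ = (b : GL (Fin 3) (mixedSpace L))) :
    star (fun i => UnitaryGroup.evalC L w ((c : Matrix (Fin 3) (Fin 3) (mixedSpace L)) i 1)) ⬝ᵥ
        H'.map w.1.embedding *ᵥ (fun i => UnitaryGroup.evalC L w ((c : Matrix (Fin 3) (Fin 3) (mixedSpace L)) i 1)) ≠ 0 := by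
  -- notation (as in ★ `star_dotProduct_form_mulVec_ne_zero_of_conj_eq`)
  set φ := UnitaryGroup.evalC L w with hφ
  set H := H'.map w.1.embedding with hH
  set cw := (c : Matrix (Fin 3) (Fin 3) (mixedSpace L)).map φ with hcw
  set cw' := ((c⁻¹ : GL (Fin 3) (mixedSpace L)) : Matrix (Fin 3) (Fin 3) (mixedSpace L)).map φ with hcw'
  set bw := ((b : GL (Fin 3) (mixedSpace L)) : Matrix (Fin 3) (Fin 3) (mixedSpace L)).map φ with hbw
  set g := (((a.1 : ↥(UnitaryGroup.arch (↥(maximalRealSubfield L)) L (IsCMField.complexConj L) 2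
      (Matrix.of fun i j : Fin 2 => if i.val + j.val + 1 = 2 then (1 : L) else 0))) :
        GL (Fin 2) (mixedSpace L)) : Matrix (Fin 2) (Fin 2) (mixedSpace L)) with hg
  set u := (((a.2 : ↥(UnitaryGroup.arch (↥(maximalRealSubfield L)) L (IsCMField.complexConj L) 1
      (Matrix.of fun i j : Fin 1 => if i.val + j.val + 1 = 1 then (1 : L) else 0))) :
        GL (Fin 1) (mixedSpace L)) : Matrix (Fin 1) (Fin 1) (mixedSpace L)) with hu
  set gw := g.map φ with hgw
  set uw := φ (u 0 0) with huw
  set v : Fin 3 → ℂ := fun i => UnitaryGroup.evalC L w ((c : Matrix (Fin 3) (Fin 3) (mixedSpace L)) i 1) with hv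
  have hvcw : v = fun i => cw i 1 := rfl
  -- invertibility of `c_w`
  have h1 : cw' * cw = 1 := by
    rw [hcw, hcw', ← Matrix.map_mul, ← Units.val_mul, inv_mul_cancel, Units.val_one, Matrix.map_one _ (map_zero φ) (map_one φ)]
  have h2 : cw * cw' = 1 := by
    rw [hcw, hcw', ← Matrix.map_mul, ← Units.val_mul, mul_inv_cancel, Units.val_one, Matrix.map_one _ (map_zero φ) (map_one φ)]
  -- `γ′_w = c_w ι_w c_w⁻¹` with the explicit pattern
  set ιw : Matrix (Fin 3) (Fin 3) ℂ := !![gw 0 0, 0, gw 0 1; 0, uw, 0; gw 1 0, 0, gw 1 1] with hιw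
  have hι : ((((endoEmbArch L a : ↥(UnitaryGroup.arch (↥(maximalRealSubfield L)) L (IsCMField.complexConj L) 3
            (Matrix.of fun i j : Fin 3 => if i.val + j.val + 1 = 3 then (1 : L) else 0))) :
            GL (Fin 3) (mixedSpace L)) : Matrix (Fin 3) (Fin 3) (mixedSpace L))).map φ = ιw := by
    rw [coe_endoEmbArch, coe_endoGL_eq, hιw]
    ext i j
    fin_cases i <;> fin_cases j <;> simp [Matrix.map_apply, hgw, huw, hg, hu]
  have hbw' : bw = cw * ιw * cw' := by
    rw [hbw, ← hι, hcw, hcw', ← Matrix.map_mul, ← Matrix.map_mul, ← Units.val_mul, ← Units.val_mul, hc]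
  have hbc : bw * cw = cw * ιw := by rw [hbw', Matrix.mul_assoc, h1, Matrix.mul_one]
  -- `v` is the `γ₂,w`-eigenvector of `γ′_w`
  have hιe : ιw *ᵥ (Pi.single 1 (1 : ℂ)) = uw • Pi.single 1 (1 : ℂ) := by
    ext i
    fin_cases i <;> simp [hιw, Matrix.mulVec, dotProduct, Fin.sum_univ_three]
  have hve : cw *ᵥ Pi.single 1 (1 : ℂ) = v := by
    rw [Matrix.mulVec_single_one]
    rfl
  have hbv : bw *ᵥ v = uw • v := by
    rw [← hve, Matrix.mulVec_mulVec, hbc, ← Matrix.mulVec_mulVec, hιe, Matrix.mulVec_smul]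
  -- unitarity of `γ′_w` and `|γ₂,w| = 1`
  have hb : bwᴴ * H * bw = H := conjTranspose_map_evalC_mul_form_mul L H' b w
  have hu1 : starRingEnd ℂ uw * uw = 1 := star_evalC_archGammaTwo_mul_self L a w
  have hu1' : uw * star uw = 1 := by rw [Complex.star_def, mul_comm]; exact hu1
  -- Step A: `vᴴ H γ′_w = γ₂,w · vᴴ H`
  have hA : star v ᵥ* (H * bw) = uw • (star v ᵥ* H) := by
    have e1 : star v ᵥ* H = star v ᵥ* (bwᴴ * H * bw) := by rw [hb]
    rw [← Matrix.vecMul_vecMul, ← Matrix.vecMul_vecMul, ← Matrix.star_mulVec, hbv, star_smul, Matrix.smul_vecMul,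
      Matrix.smul_vecMul, Matrix.vecMul_vecMul] at e1
    rw [e1, smul_smul, hu1', one_smul]
  -- Step B: `r := vᴴ H c_w` is a left `γ₂,w`-eigenvector of the pattern
  set r : Fin 3 → ℂ := star v ᵥ* H ᵥ* cw with hr
  have hB : r ᵥ* ιw = uw • r := by
    rw [hr, Matrix.vecMul_vecMul, ← hbc, ← Matrix.vecMul_vecMul, Matrix.vecMul_vecMul (star v) H bw, hA, Matrix.smul_vecMul]
  -- Step C: the outer coordinates of `r` vanish — HERE `σ_w(χ_g(γ₂)) ≠ 0` replaces `G`-regularity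
  have hB0 : r 0 * gw 0 0 + r 2 * gw 1 0 = uw * r 0 := by
    have := congrFun hB 0
    simpa [hιw, Matrix.vecMul, dotProduct, Fin.sum_univ_three] using this
  have hB2 : r 0 * gw 0 1 + r 2 * gw 1 1 = uw * r 2 := by
    have := congrFun hB 2
    simpa [hιw, Matrix.vecMul, dotProduct, Fin.sum_univ_three] using this
  have hs : uw * uw - gw.trace * uw + gw.det ≠ 0 := by
    have h := hw
    rw [evalC_eval_archCharpolyTwo_archGammaTwo] at h
    exact h
  rw [Matrix.trace_fin_two, Matrix.det_fin_two] at hs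
  have hr0 : r 0 = 0 := by
    have h : (uw * uw - (gw 0 0 + gw 1 1) * uw + (gw 0 0 * gw 1 1 - gw 0 1 * gw 1 0)) * r 0 = 0 := by
      linear_combination (gw 1 1 - uw) * hB0 - gw 1 0 * hB2
    exact (mul_eq_zero.1 h).resolve_left hs
  have hr2 : r 2 = 0 := by
    have h : (uw * uw - (gw 0 0 + gw 1 1) * uw + (gw 0 0 * gw 1 1 - gw 0 1 * gw 1 0)) * r 2 = 0 := by
      linear_combination (gw 0 0 - uw) * hB2 - gw 0 1 * hB0
    exact (mul_eq_zero.1 h).resolve_left hs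
  -- Step D: `r₁ = vᴴ H v`
  have hr1 : r 1 = star v ⬝ᵥ H *ᵥ v := by
    rw [Matrix.dotProduct_mulVec]
    rfl
  -- Step E: `vᴴ H v = 0` would give `vᴴ H = 0`, contradicting `det w(H′) ≠ 0` and `v ≠ 0`
  intro hz
  have hr_zero : r = 0 := by
    funext i
    fin_cases i
    · exact hr0
    · exact hr1.trans hz
    · exact hr2
  have hvH : star v ᵥ* H = 0 := by
    have : star v ᵥ* H = r ᵥ* cw' := by
      rw [hr, Matrix.vecMul_vecMul, Matrix.vecMul_vecMul, h2, Matrix.mul_one]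
    rw [this, hr_zero, Matrix.zero_vecMul]
  have hdetH' : H'.det ≠ 0 := by
    intro hdet
    obtain ⟨x, hx, hHx⟩ := Matrix.exists_mulVec_eq_zero_iff.mpr hdet
    refine hx (hanis x ?_)
    unfold hermForm
    rw [hHx, dotProduct_zero]
  have hdetH : H.det ≠ 0 := by
    rw [hH, ← RingHom.mapMatrix_apply, ← RingHom.map_det]
    exact (_root_.map_ne_zero _).2 hdetH'
  have hv0 : v ≠ 0 := by
    intro hv0
    have h11 := congrFun (congrFun h1 1) 1
    rw [Matrix.mul_apply, Matrix.one_apply_eq] at h11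
    have hcol : ∀ j, cw j 1 = 0 := fun j => by
      have := congrFun hv0 j
      simpa [hvcw] using this
    simp [hcol] at h11
  have hsv0 : star v ≠ 0 := fun h => hv0 (star_eq_zero.1 h)
  exact hdetH (Matrix.exists_vecMul_eq_zero_iff.1 ⟨star v, hsv0, hvH⟩)

/-! ## §3 `Re tr(P_wᴴ w(H′) P_w) ≠ 0`, `κ‴_w = ±1`, `κ_w ≠ 0` at a `(G,H)`-regular local matching pair -/

/-- **`Re tr(P_wᴴ · w(H′) · P_w) ≠ 0` on a matching pair with `σ_w(χ_g(γ₂)) ≠ 0`** (`H′` `c`-hermitian and anisotropic): `P_w = v (s q)ᵀ` with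
`s = σ_w(χ_g(γ₂)) ≠ 0`, `q` a row of `c_w⁻¹` (★ `archEigenlineProjector_eq_vecMulVec_of_conj_eq`), so `tr(P_wᴴ H P_w) = ‖s q‖² · vᴴ H v` with
`vᴴ H v ∈ ℝ ∖ {0}` (§2).  This is the real quantity whose sign is `κ‴_w`. [cite: Rogawski1990, §14.6 p. 242; §4.9 p. 55] -/
theorem re_trace_archEigenlineProjector_ne_zero_of_evalC_ne_zero (hherm : (H'.map (cmConjRingHom L)).transpose = H')
    (hanis : ∀ x : Fin 3 → L, hermForm (cmConjRingHom L) H' x x = 0 → x = 0) (hp : IsArchNormPair L H' a b)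
    (hw : UnitaryGroup.evalC L w ((archCharpolyTwo L a).eval (archGammaTwo L a)) ≠ 0) :
    (Matrix.trace ((archEigenlineProjector L H' a w b)ᴴ * H'.map w.1.embedding * archEigenlineProjector L H' a w b)).re ≠ 0 := by
  have hp' := hp
  rw [isArchNormPair_iff] at hp'
  obtain ⟨c, hc⟩ := isConj_iff.1 hp'
  set φ := UnitaryGroup.evalC L w with hφ
  set H := H'.map w.1.embedding with hH
  set v : Fin 3 → ℂ := fun i => φ ((c : Matrix (Fin 3) (Fin 3) (mixedSpace L)) i 1) with hv
  set s : ℂ := φ ((archCharpolyTwo L a).eval (archGammaTwo L a)) with hsdef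
  set q : Fin 3 → ℂ := fun j => s * φ (((c⁻¹ : GL (Fin 3) (mixedSpace L)) : Matrix (Fin 3) (Fin 3) (mixedSpace L)) 1 j) with hq
  have hP : archEigenlineProjector L H' a w b = vecMulVec v q := archEigenlineProjector_eq_vecMulVec_of_conj_eq L H' a b w c hc
  have hs : s ≠ 0 := hw
  -- `z = vᴴ H v` is real and non-zero
  have hz : star v ⬝ᵥ H *ᵥ v ≠ 0 := star_dotProduct_form_mulVec_ne_zero_of_conj_eq_of_evalC_ne_zero L H' a b w hanis hw c hc
  have hHh : Hᴴ = H := by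
    have hcomp : (star : ℂ → ℂ) ∘ (w.1.embedding : L → ℂ) = (w.1.embedding : L → ℂ) ∘ (cmConjRingHom L : L → L) := by
      funext x
      simp only [Function.comp_apply, embedding_cmConjRingHom, Complex.star_def]
    rw [hH, Matrix.conjTranspose, Matrix.transpose_map, Matrix.map_map, hcomp, ← Matrix.map_map, ← Matrix.transpose_map, hherm]
  have hzz : star (star v ⬝ᵥ H *ᵥ v) = star v ⬝ᵥ H *ᵥ v := by
    rw [← Matrix.star_dotProduct_star, star_star, Matrix.star_mulVec, hHh, ← Matrix.dotProduct_mulVec]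
  have hzre : ((star v ⬝ᵥ H *ᵥ v).re : ℂ) = star v ⬝ᵥ H *ᵥ v := Complex.conj_eq_iff_re.1 (by rw [← Complex.star_def]; exact hzz)
  have hzre0 : (star v ⬝ᵥ H *ᵥ v).re ≠ 0 := by
    intro h0
    apply hz
    rw [← hzre, h0, Complex.ofReal_zero]
  -- `q ≠ 0`: a row of the invertible `c_w⁻¹`, scaled by `s ≠ 0`
  have hq0 : q ≠ 0 := by
    set cw := (c : Matrix (Fin 3) (Fin 3) (mixedSpace L)).map φ with hcw
    set cw' := ((c⁻¹ : GL (Fin 3) (mixedSpace L)) : Matrix (Fin 3) (Fin 3) (mixedSpace L)).map φ with hcw'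
    have h1 : cw' * cw = 1 := by
      rw [hcw, hcw', ← Matrix.map_mul, ← Units.val_mul, inv_mul_cancel, Units.val_one, Matrix.map_one _ (map_zero φ) (map_one φ)]
    intro hq0
    have h11 := congrFun (congrFun h1 1) 1
    rw [Matrix.mul_apply, Matrix.one_apply_eq] at h11
    have hrow : ∀ j, cw' 1 j = 0 := fun j => by
      have := congrFun hq0 j
      simp only [hq, Pi.zero_apply, mul_eq_zero] at this
      exact this.resolve_left hs
    simp [hrow] at h11
  have hQ : (∑ i, Complex.normSq (q i)) ≠ 0 := fun h => hq0 ((sum_normSq_eq_zero_iff_gh q).1 h)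
  -- assemble
  rw [hP, trace_conjTranspose_vecMulVec_mul_mul_gh, star_dotProduct_self_eq_ofReal_gh, Complex.re_ofReal_mul]
  exact mul_ne_zero hQ hzre0

/-- **`κ‴_w(γ_H, γ′) ≠ 0`** at a `(G,H)`-regular local matching pair (`σ_w(χ_g(γ₂)) ≠ 0`; `H′` `c`-hermitian anisotropic).
[cite: Rogawski1990, §14.6 p. 242] -/
theorem archKappaSignAt_ne_zero_of_evalC_ne_zero (hherm : (H'.map (cmConjRingHom L)).transpose = H')
    (hanis : ∀ x : Fin 3 → L, hermForm (cmConjRingHom L) H' x x = 0 → x = 0) (hp : IsArchNormPair L H' a b)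
    (hw : UnitaryGroup.evalC L w ((archCharpolyTwo L a).eval (archGammaTwo L a)) ≠ 0) :
    archKappaSignAt L H' a w b ≠ 0 := by
  have h := re_trace_archEigenlineProjector_ne_zero_of_evalC_ne_zero L H' a b w hherm hanis hp hw
  unfold archKappaSignAt
  rcases lt_trichotomy ((Matrix.trace ((archEigenlineProjector L H' a w b)ᴴ * H'.map w.1.embedding *
      archEigenlineProjector L H' a w b)).re) 0 with hlt | heq | hgt
  · rw [sign_neg hlt]; decide
  · exact absurd heq h
  · rw [sign_pos hgt]; decide

/-- **`κ‴_w(γ_H, γ′) = ±1` AT EVERY `(G,H)`-REGULAR LOCAL MATCHING PAIR** («`κ(γ, ψ_v(iγ))` is equal to `±1`», now without `G`-regularity and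
for non-rational pairs): the sign of the non-zero real number `Re tr(P_wᴴ w(H′) P_w)`. [cite: Rogawski1990, §14.6 p. 242] [cite: LanglandsShelstad1987, §2] -/
theorem archKappaSignAt_eq_one_or_eq_neg_one_of_evalC_ne_zero (hherm : (H'.map (cmConjRingHom L)).transpose = H')
    (hanis : ∀ x : Fin 3 → L, hermForm (cmConjRingHom L) H' x x = 0 → x = 0) (hp : IsArchNormPair L H' a b)
    (hw : UnitaryGroup.evalC L w ((archCharpolyTwo L a).eval (archGammaTwo L a)) ≠ 0) :
    archKappaSignAt L H' a w b = 1 ∨ archKappaSignAt L H' a w b = -1 := by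
  have h := re_trace_archEigenlineProjector_ne_zero_of_evalC_ne_zero L H' a b w hherm hanis hp hw
  unfold archKappaSignAt
  rcases lt_trichotomy ((Matrix.trace ((archEigenlineProjector L H' a w b)ᴴ * H'.map w.1.embedding *
      archEigenlineProjector L H' a w b)).re) 0 with hlt | heq | hgt
  · right; rw [sign_neg hlt]; decide
  · exact absurd heq h
  · left; rw [sign_pos hgt]; decide

/-- **`κ_w(γ_H, γ′) ≠ 0`** at a `(G,H)`-regular local matching pair — ★ `archKappaAt_ne_zero` with `IsArchGRegular` weakened to `σ_w(χ_g(γ₂)) ≠ 0`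
(`κ_w = κ‴_w · η_w(H′)`, ★ `archKappaAt_eq_archKappaSignAt_mul`, ★ `archMajoritySign_ne_zero`). [cite: Rogawski1990, §14.6 p. 242] -/
theorem archKappaAt_ne_zero_of_evalC_ne_zero (hherm : (H'.map (cmConjRingHom L)).transpose = H')
    (hanis : ∀ x : Fin 3 → L, hermForm (cmConjRingHom L) H' x x = 0 → x = 0) (hp : IsArchNormPair L H' a b)
    (hw : UnitaryGroup.evalC L w ((archCharpolyTwo L a).eval (archGammaTwo L a)) ≠ 0) :
    archKappaAt L H' a w b ≠ 0 := by
  rw [archKappaAt_eq_archKappaSignAt_mul]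
  exact mul_ne_zero (archKappaSignAt_ne_zero_of_evalC_ne_zero L H' a b w hherm hanis hp hw) (archMajoritySign_ne_zero L H' w)

/-! ## §4 `Δ″_∞ ≠ 0` and `Δ‴_∞ ≠ 0` at every `(G,H)`-regular local matching pair -/

open scoped Classical in
/-- **`Δ″_∞(γ_H, γ′) ≠ 0` AT A `(G,H)`-REGULAR LOCAL MATCHING PAIR** (`ι(γ_H) ↔ γ′`, `χ_g(γ₂) ∈ (L ⊗ ℝ)ˣ`; `H′` `c`-hermitian anisotropic; any Hecke
character `μ`): `Δ″_∞ = τ_∞ · D_{G∕H,∞} · ∏_w κ_w` at a matching pair (★ `archExplicitDelta_of_isArchNormPair`) with every factor non-zero (§1, §3) —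
★ N2∞ `isArchNondegenerate_archExplicitTransferFactor` with `G`-regularity weakened to `(G,H)`-regularity. [cite: Rogawski1990, §4.9 pp. 54–55; §8.2 Prop. 8.2.1 p. 117; §14.6 p. 242] -/
theorem archExplicitDelta_ne_zero_of_isUnit_eval (μ : HeckeCharacter L) (hherm : (H'.map (cmConjRingHom L)).transpose = H')
    (hanis : ∀ x : Fin 3 → L, hermForm (cmConjRingHom L) H' x x = 0 → x = 0) (hp : IsArchNormPair L H' a b)
    (hunit : IsUnit ((archCharpolyTwo L a).eval (archGammaTwo L a))) :
    archExplicitDelta L H' a μ b ≠ 0 := by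
  rw [archExplicitDelta_of_isArchNormPair L H' a μ hp]
  refine mul_ne_zero (mul_ne_zero (archTau_ne_zero_of_isUnit_eval L a μ hunit)
    (Complex.ofReal_ne_zero.2 (archWeylRatio_ne_zero_of_isUnit_eval L a hunit))) ?_
  rw [Int.cast_ne_zero]
  exact Finset.prod_ne_zero_iff.2 fun w _ => archKappaAt_ne_zero_of_evalC_ne_zero L H' a b w hherm hanis hp (evalC_ne_zero_of_isUnit L hunit w)

open scoped Classical in
/-- **`Δ‴_∞(γ_H, γ′) ≠ 0` AT A `(G,H)`-REGULAR LOCAL MATCHING PAIR** — the factor OF RECORD ★ `archCanonicalDelta` (`Δ‴_∞ = τ_∞ · D_{G∕H,∞} · ∏_w κ‴_w`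
at a matching pair, ★ `archCanonicalDelta_of_isArchNormPair`); this is the `c_∞ ≠ 0`-shaped DATA fact of Lemma 14.5.2 (b) («`c_∞ = Δ_{G∕H}(γ₀)⁻¹`»)
at print's singular `γ₀ ∈ M`, for LOCAL (not only rational, cf. ★ `archCanonicalDelta_rationalArch_ne_zero_of_eval_ne_zero`) pairs.
[cite: Rogawski1990, §8.2 Prop. 8.2.1 p. 117; §14.5 Lemma 14.5.2 (b) proof p. 238; §4.9 p. 55] -/
theorem archCanonicalDelta_ne_zero_of_isUnit_eval (μ : HeckeCharacter L) (hherm : (H'.map (cmConjRingHom L)).transpose = H')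
    (hanis : ∀ x : Fin 3 → L, hermForm (cmConjRingHom L) H' x x = 0 → x = 0) (hp : IsArchNormPair L H' a b)
    (hunit : IsUnit ((archCharpolyTwo L a).eval (archGammaTwo L a))) :
    archCanonicalDelta L H' a μ b ≠ 0 := by
  rw [archCanonicalDelta_of_isArchNormPair L H' a μ hp]
  refine mul_ne_zero (mul_ne_zero (archTau_ne_zero_of_isUnit_eval L a μ hunit)
    (Complex.ofReal_ne_zero.2 (archWeylRatio_ne_zero_of_isUnit_eval L a hunit))) ?_
  rw [Int.cast_ne_zero]
  exact Finset.prod_ne_zero_iff.2 fun w _ =>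
    archKappaSignAt_ne_zero_of_evalC_ne_zero L H' a b w hherm hanis hp (evalC_ne_zero_of_isUnit L hunit w)

end Place

end Literature.NumberTheory.Rogawski1990

end
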